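import Mathlib
import HarnessLib
import Summits.HubbardSuperconductivity.HubbardSuperconductivity.Theorems.KLProgrammePerturbedFermiCurveCompChain

/-!
# Route `KLProgramme` — crux C4a, S3 brick (B2, TANGENCY): carrier-free calculus for the anisotropy defect at the tangency configuration —
# `|∂_t|₀ f(2Γ(θ+t) − Γ(φ+θ+t))| ≤ C·φ²` for a curve `Γ` inside the zero level of `f`

Cell `gate-hubbard-kl`, lane hubbard-kl-c4a-1 (g6); helper for stub (C) `stub_twoLeg_curvature` of the engine-flow child `KLRegimeEngineV17F2`
(stmt-HubbardSuperconductivity-20437); memo HOME/hubbard-kl-c4a-1/C4A-PLAN.md §24.4 (ii), §24.6 (B2, near (T)).  At the tangency configuration `(ρ,ϑ) = (0,0)` of the pp loop,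
with the loop on the Fermi curve (`e = 0`), the partner band is `t ↦ f(Γ(θ+t) + Γ(θ+t) − Γ(φ+θ+t))` (`f = e_K − μ`, `Γ = Φ(0,·)`, `f ∘ Γ ≡ 0`); its t-derivative at
`t = 0` — the anisotropy defect `𝒜` — vanishes to SECOND order in the loop angle `φ`.  The mechanism is one-dimensional: with `a = Γ(θ)`, `b = Γ′(θ)`, `c = Γ″(θ)`,
`𝒜 = Df(a − φb − R₀)[b − φc − R₁]` (`R₀, R₁` = Taylor remainders of `Γ, Γ′`, `O(φ²)`), and `ψ(φ) := Df(a − φb)[b − φc]` has `ψ(0) = (f∘Γ)′(θ) = 0`,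
`ψ′(0) = −(f∘Γ)″(θ) = 0`.

* `abs_deriv_comp_add_sub_le` — perturbing the argument curve: `|∂_t f(X+Δ) − ∂_t f(X)|₀ ≤ K₂‖Δ(0)‖‖X′(0)‖ + K₁‖Δ′(0)‖`;
* `norm_sub_sub_smul_le_sq`, `abs_le_sq_of_hasDerivAt_two` — second-order Taylor estimates from two mean-value steps;
* **`abs_deriv_tangency_core_le`** — `|∂_t|₀ f(Γ(θ+t) + Γ(θ+t) − Γ(φ+θ+t))| ≤ (K₃D₁²(D₁ + |φ|D₂) + K₂D₂(3D₁ + |φ|D₂) + K₁D₃)·φ²`.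

Pure calculus; nothing about the model's sizes; nothing asserts superconductivity.  References: FST II CPAM 51 (1998) §3 (tangential regularity); BGM 2006 §2.4 [cite: BenfattoGiulianiMastropietro2006].
-/

noncomputable section

namespace Summit.HubbardSuperconductivity.HubbardSuperconductivity.Theorems.C4a

set_option linter.dupNamespace false -- summit = problem name (single-conjunct summit), D-0017
set_option maxSynthPendingDepth 3 -- nested operator-norm instances (third Fréchet derivatives)

open Real Set Filter
open scoped Topology
open Summit.HubbardSuperconductivity.HubbardSuperconductivity.Theorems.PerturbedFermiCurve

section Abstract

variable {V : Type*} [NormedAddCommGroup V] [NormedSpace ℝ V]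

/-- **Perturbing the argument curve**: `|∂_t|₀ f(X(t) + Δ(t)) − ∂_t|₀ f(X(t))| ≤ K₂·‖Δ(0)‖·‖X′(0)‖ + K₁·‖Δ′(0)‖`. [folklore] -/
theorem abs_deriv_comp_add_sub_le {f : V → ℝ} (hf : ContDiff ℝ 2 f) {K₁ K₂ : ℝ} (hK₁ : ∀ x, ‖fderiv ℝ f x‖ ≤ K₁)
    (hK₂ : ∀ x, ‖iteratedFDeriv ℝ 2 f x‖ ≤ K₂) {X Δ : ℝ → V} (hX : DifferentiableAt ℝ X 0) (hΔ : DifferentiableAt ℝ Δ 0) :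
    |deriv (fun t : ℝ => f (X t + Δ t)) 0 - deriv (fun t : ℝ => f (X t)) 0| ≤ K₂ * ‖Δ 0‖ * ‖deriv X 0‖ + K₁ * ‖deriv Δ 0‖ := by
  have hfd : Differentiable ℝ f := hf.differentiable (by norm_num)
  have h1 : HasDerivAt (fun t : ℝ => f (X t + Δ t)) (fderiv ℝ f (X 0 + Δ 0) (deriv X 0 + deriv Δ 0)) 0 :=
    (hfd (X 0 + Δ 0)).hasFDerivAt.comp_hasDerivAt_of_eq 0 (hX.hasDerivAt.add hΔ.hasDerivAt) rfl
  have h2 : HasDerivAt (fun t : ℝ => f (X t)) (fderiv ℝ f (X 0) (deriv X 0)) 0 :=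
    (hfd (X 0)).hasFDerivAt.comp_hasDerivAt_of_eq 0 hX.hasDerivAt rfl
  rw [h1.deriv, h2.deriv]
  have key : fderiv ℝ f (X 0 + Δ 0) (deriv X 0 + deriv Δ 0) - fderiv ℝ f (X 0) (deriv X 0) =
      (fderiv ℝ f (X 0 + Δ 0) - fderiv ℝ f (X 0)) (deriv X 0) + fderiv ℝ f (X 0 + Δ 0) (deriv Δ 0) := by
    simp only [map_add, show ∀ (P Q : V →L[ℝ] ℝ) (z : V), (P - Q) z = P z - Q z from fun _ _ _ => rfl]; ring
  rw [key]
  have hLip : ‖fderiv ℝ f (X 0 + Δ 0) - fderiv ℝ f (X 0)‖ ≤ K₂ * ‖Δ 0‖ := by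
    have hdiff : Differentiable ℝ (fderiv ℝ f) := (hf.fderiv_right (m := 1) (by norm_num)).differentiable one_ne_zero
    have h := (convex_univ (𝕜 := ℝ) (E := V)).norm_image_sub_le_of_norm_fderiv_le (𝕜 := ℝ) (f := fderiv ℝ f) (fun z _ => hdiff z)
      (fun z _ => by rw [norm_fderiv_two_eq_norm_iteratedFDeriv]; exact hK₂ z) (mem_univ (X 0)) (mem_univ (X 0 + Δ 0))
    rwa [add_sub_cancel_left] at h
  have t1 : |(fderiv ℝ f (X 0 + Δ 0) - fderiv ℝ f (X 0)) (deriv X 0)| ≤ K₂ * ‖Δ 0‖ * ‖deriv X 0‖ := by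
    rw [← Real.norm_eq_abs]
    exact ((fderiv ℝ f (X 0 + Δ 0) - fderiv ℝ f (X 0)).le_opNorm _).trans (mul_le_mul_of_nonneg_right hLip (norm_nonneg _))
  have t2 : |fderiv ℝ f (X 0 + Δ 0) (deriv Δ 0)| ≤ K₁ * ‖deriv Δ 0‖ := by
    rw [← Real.norm_eq_abs]
    exact ((fderiv ℝ f (X 0 + Δ 0)).le_opNorm _).trans (mul_le_mul_of_nonneg_right (hK₁ _) (norm_nonneg _))
  exact (abs_add_le _ _).trans (add_le_add t1 t2)

/-- If `y` lies between `0` and `x` then `|y| ≤ |x|`. -/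
theorem abs_le_abs_of_mem_uIcc_zero {x y : ℝ} (h : y ∈ uIcc 0 x) : |y| ≤ |x| := by
  rcases mem_uIcc.1 h with ⟨h1, h2⟩ | ⟨h1, h2⟩
  · rw [abs_of_nonneg h1, abs_of_nonneg (h1.trans h2)]; exact h2
  · rw [abs_of_nonpos h2, abs_of_nonpos (h1.trans h2)]; linarith

/-- **Second-order Taylor estimate from two mean-value steps** (vector-valued): if `g′ = g₁`, `g₁′ = g₂` and `‖g₂‖ ≤ M` between `0` and `φ`, then
`‖g(φ) − g(0) − φ·g₁(0)‖ ≤ M·φ²`. [folklore] -/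
theorem norm_sub_sub_smul_le_sq {g g₁ g₂ : ℝ → V} (h₀ : ∀ x, HasDerivAt g (g₁ x) x) (h₁ : ∀ x, HasDerivAt g₁ (g₂ x) x) {M φ : ℝ}
    (hM : ∀ x, |x| ≤ |φ| → ‖g₂ x‖ ≤ M) : ‖g φ - g 0 - φ • g₁ 0‖ ≤ M * φ ^ 2 := by
  have hM0 : 0 ≤ M := (norm_nonneg _).trans (hM 0 (by rw [abs_zero]; exact abs_nonneg φ))
  -- step A: `‖g₁ x − g₁ 0‖ ≤ M|x|` between `0` and `φ`
  have stepA : ∀ x, |x| ≤ |φ| → ‖g₁ x - g₁ 0‖ ≤ M * |x| := fun x hx => by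
    have h := (convex_uIcc (0 : ℝ) x).norm_image_sub_le_of_norm_hasDerivWithin_le (f := g₁) (f' := g₂)
      (fun y _ => (h₁ y).hasDerivWithinAt) (fun y hy => hM y ((abs_le_abs_of_mem_uIcc_zero hy).trans hx)) left_mem_uIcc right_mem_uIcc
    rw [sub_zero, Real.norm_eq_abs] at h
    exact h
  -- step B: the function `G(x) = g(x) − g(0) − x·g₁(0)` has `G′ = g₁ − g₁(0)` and `G(0) = 0`
  have hG' : ∀ x, HasDerivAt (fun y : ℝ => g y - g 0 - y • g₁ 0) (g₁ x - g₁ 0) x := fun x =>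
    (((h₀ x).sub_const (g 0)).sub ((hasDerivAt_id' x).smul_const (g₁ 0))).congr_deriv (by rw [one_smul])
  have h := (convex_uIcc (0 : ℝ) φ).norm_image_sub_le_of_norm_hasDerivWithin_le (f := fun y : ℝ => g y - g 0 - y • g₁ 0)
    (f' := fun x => g₁ x - g₁ 0) (fun y _ => (hG' y).hasDerivWithinAt)
    (fun y hy => (stepA y (abs_le_abs_of_mem_uIcc_zero hy)).trans (mul_le_mul_of_nonneg_left (abs_le_abs_of_mem_uIcc_zero hy) hM0))
    left_mem_uIcc right_mem_uIcc
  have e : (g φ - g 0 - φ • g₁ 0) - (g 0 - g 0 - (0 : ℝ) • g₁ 0) = g φ - g 0 - φ • g₁ 0 := by rw [zero_smul, sub_self, sub_zero, sub_zero]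
  rw [e, sub_zero, Real.norm_eq_abs] at h
  calc ‖g φ - g 0 - φ • g₁ 0‖ ≤ M * |φ| * |φ| := h
    _ = M * φ ^ 2 := by rw [mul_assoc, abs_mul_abs_self, sq]

/-- **Second-order Taylor estimate** (scalar): `ψ(0) = 0`, `ψ′(0) = 0`, `|ψ″| ≤ M` between `0` and `φ` ⇒ `|ψ(φ)| ≤ M·φ²`. [folklore] -/
theorem abs_le_sq_of_hasDerivAt_two {ψ ψ₁ ψ₂ : ℝ → ℝ} (h₀ : ∀ x, HasDerivAt ψ (ψ₁ x) x) (h₁ : ∀ x, HasDerivAt ψ₁ (ψ₂ x) x) (hψ : ψ 0 = 0)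
    (hψ₁ : ψ₁ 0 = 0) {M φ : ℝ} (hM : ∀ x, |x| ≤ |φ| → |ψ₂ x| ≤ M) : |ψ φ| ≤ M * φ ^ 2 := by
  have h := norm_sub_sub_smul_le_sq h₀ h₁ (φ := φ) (fun x hx => by rw [Real.norm_eq_abs]; exact hM x hx)
  rwa [hψ, hψ₁, smul_zero, sub_zero, sub_zero, Real.norm_eq_abs] at h

/-- **THE TANGENCY CORE**: for `f ∈ C⁴` with `‖Df‖ ≤ K₁`, `‖D²f‖ ≤ K₂`, `‖D³f‖ ≤ K₃`, a `C⁴` curve `Γ` in the zero level of `f` with `‖Γ^{(j)}‖ ≤ D_j` (`j ≤ 3`),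
and all `θ, φ`: `|∂_t|₀ f(Γ(θ+t) + Γ(θ+t) − Γ(φ+θ+t))| ≤ (K₃D₁²(D₁ + |φ|D₂) + K₂D₂(3D₁ + |φ|D₂) + K₁D₃)·φ²` — the anisotropy defect of the co-moving pp loop
vanishes to second order in the loop angle at the tangency configuration. -/
theorem abs_deriv_tangency_core_le {f : V → ℝ} (hf : ContDiff ℝ 4 f) {K₁ K₂ K₃ : ℝ} (hK₁ : ∀ x, ‖fderiv ℝ f x‖ ≤ K₁)
    (hK₂ : ∀ x, ‖iteratedFDeriv ℝ 2 f x‖ ≤ K₂) (hK₃ : ∀ x, ‖iteratedFDeriv ℝ 3 f x‖ ≤ K₃) {Γ : ℝ → V} (hΓ : ContDiff ℝ 4 Γ)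
    (hΓ0 : ∀ s, f (Γ s) = 0) {D₁ D₂ D₃ : ℝ} (hD₁ : ∀ s, ‖iteratedDeriv 1 Γ s‖ ≤ D₁) (hD₂ : ∀ s, ‖iteratedDeriv 2 Γ s‖ ≤ D₂)
    (hD₃ : ∀ s, ‖iteratedDeriv 3 Γ s‖ ≤ D₃) (θ φ : ℝ) :
    |deriv (fun t : ℝ => f (Γ (θ + t) + Γ (θ + t) - Γ (φ + θ + t))) 0| ≤
      (K₃ * D₁ ^ 2 * (D₁ + |φ| * D₂) + K₂ * D₂ * (3 * D₁ + |φ| * D₂) + K₁ * D₃) * φ ^ 2 := by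
  have hK₁0 : 0 ≤ K₁ := (norm_nonneg _).trans (hK₁ 0)
  have hK₂0 : 0 ≤ K₂ := (norm_nonneg _).trans (hK₂ 0)
  have hK₃0 : 0 ≤ K₃ := (norm_nonneg _).trans (hK₃ 0)
  have hD₁0 : 0 ≤ D₁ := (norm_nonneg _).trans (hD₁ 0)
  have hD₂0 : 0 ≤ D₂ := (norm_nonneg _).trans (hD₂ 0)
  have hD₃0 : 0 ≤ D₃ := (norm_nonneg _).trans (hD₃ 0)
  -- derivative towers
  have hΓd : ∀ s, HasDerivAt Γ (iteratedDeriv 1 Γ s) s := fun s => by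
    have h := hasDerivAt_iteratedDeriv_of_contDiff_four hΓ (show 0 < 4 by norm_num) s
    rwa [iteratedDeriv_zero] at h
  have hΓ1d : ∀ s, HasDerivAt (iteratedDeriv 1 Γ) (iteratedDeriv 2 Γ s) s := fun s =>
    hasDerivAt_iteratedDeriv_of_contDiff_four hΓ (show 1 < 4 by norm_num) s
  have hΓ2d : ∀ s, HasDerivAt (iteratedDeriv 2 Γ) (iteratedDeriv 3 Γ s) s := fun s =>
    hasDerivAt_iteratedDeriv_of_contDiff_four hΓ (show 2 < 4 by norm_num) s
  have hfd : Differentiable ℝ f := hf.differentiable (by norm_num)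
  have hf1d : Differentiable ℝ (fderiv ℝ f) := (hf.fderiv_right (m := 3) (by norm_num)).differentiable (by norm_num)
  have hf2d : Differentiable ℝ (fderiv ℝ (fderiv ℝ f)) :=
    ((hf.fderiv_right (m := 3) (by norm_num)).fderiv_right (m := 2) (by norm_num)).differentiable (by norm_num)
  -- the curve sits in the zero level: `(f∘Γ)′ = (f∘Γ)″ = 0`
  have hconst : f ∘ Γ = fun _ => (0 : ℝ) := funext fun s => hΓ0 s
  have hc1 : fderiv ℝ f (Γ θ) (iteratedDeriv 1 Γ θ) = 0 := by
    rw [← iteratedDeriv_one_comp_eq hf hΓ θ, hconst, iteratedDeriv_const]; simp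
  have hc2 : fderiv ℝ (fderiv ℝ f) (Γ θ) (iteratedDeriv 1 Γ θ) (iteratedDeriv 1 Γ θ) + fderiv ℝ f (Γ θ) (iteratedDeriv 2 Γ θ) = 0 := by
    rw [← iteratedDeriv_two_comp_eq hf hΓ θ, hconst, iteratedDeriv_const]; simp
  -- Taylor remainders of `Γ` and `Γ′` at `θ`
  have hR₀n : ‖Γ (φ + θ) - Γ θ - φ • iteratedDeriv 1 Γ θ‖ ≤ D₂ * φ ^ 2 := by
    have h := norm_sub_sub_smul_le_sq (g := fun x : ℝ => Γ (x + θ)) (g₁ := fun x : ℝ => iteratedDeriv 1 Γ (x + θ))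
      (g₂ := fun x : ℝ => iteratedDeriv 2 Γ (x + θ)) (fun x => HasDerivAt.comp_add_const x θ (hΓd (x + θ)))
      (fun x => HasDerivAt.comp_add_const x θ (hΓ1d (x + θ))) (φ := φ) (M := D₂) (fun x _ => hD₂ (x + θ))
    simpa only [zero_add] using h
  have hR₁n : ‖iteratedDeriv 1 Γ (φ + θ) - iteratedDeriv 1 Γ θ - φ • iteratedDeriv 2 Γ θ‖ ≤ D₃ * φ ^ 2 := by
    have h := norm_sub_sub_smul_le_sq (g := fun x : ℝ => iteratedDeriv 1 Γ (x + θ)) (g₁ := fun x : ℝ => iteratedDeriv 2 Γ (x + θ))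
      (g₂ := fun x : ℝ => iteratedDeriv 3 Γ (x + θ)) (fun x => HasDerivAt.comp_add_const x θ (hΓ1d (x + θ)))
      (fun x => HasDerivAt.comp_add_const x θ (hΓ2d (x + θ))) (φ := φ) (M := D₃) (fun x _ => hD₃ (x + θ))
    simpa only [zero_add] using h
  -- the derivative of the partner band at `t = 0`
  have hY : HasDerivAt (fun t : ℝ => Γ (θ + t) + Γ (θ + t) - Γ (φ + θ + t))
      (iteratedDeriv 1 Γ θ + iteratedDeriv 1 Γ θ - iteratedDeriv 1 Γ (φ + θ)) 0 := by
    have h1 : HasDerivAt (fun t : ℝ => Γ (θ + t)) (iteratedDeriv 1 Γ θ) 0 :=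
      HasDerivAt.comp_const_add θ 0 (by rw [add_zero]; exact hΓd θ)
    have h2 : HasDerivAt (fun t : ℝ => Γ (φ + θ + t)) (iteratedDeriv 1 Γ (φ + θ)) 0 :=
      HasDerivAt.comp_const_add (φ + θ) 0 (by rw [add_zero]; exact hΓd (φ + θ))
    exact (h1.add h1).sub h2
  have hE : HasDerivAt (fun t : ℝ => f (Γ (θ + t) + Γ (θ + t) - Γ (φ + θ + t)))
      (fderiv ℝ f (Γ θ + Γ θ - Γ (φ + θ)) (iteratedDeriv 1 Γ θ + iteratedDeriv 1 Γ θ - iteratedDeriv 1 Γ (φ + θ))) 0 :=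
    (hfd _).hasFDerivAt.comp_hasDerivAt_of_eq 0 hY (by simp only [add_zero])
  rw [hE.deriv]
  -- abbreviations
  set a := Γ θ with ha
  set b := iteratedDeriv 1 Γ θ with hb
  set c := iteratedDeriv 2 Γ θ with hc
  set R₀ := Γ (φ + θ) - a - φ • b with hR₀
  set R₁ := iteratedDeriv 1 Γ (φ + θ) - b - φ • c with hR₁
  have hbn : ‖b‖ ≤ D₁ := hD₁ θ
  have hcn : ‖c‖ ≤ D₂ := hD₂ θ
  have e0 : a + a - Γ (φ + θ) = (a - φ • b) - R₀ := by rw [hR₀]; abel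
  have e1 : b + b - iteratedDeriv 1 Γ (φ + θ) = (b - φ • c) - R₁ := by rw [hR₁]; abel
  rw [e0, e1]
  -- the one-variable function `ψ(x) = Df(a − x b)[b − x c]` and its first two derivatives
  have hl : ∀ x : ℝ, HasDerivAt (fun y : ℝ => a - y • b) (-b) x := fun x =>
    (((hasDerivAt_id' x).smul_const b).const_sub a).congr_deriv (by rw [one_smul])
  have hv : ∀ x : ℝ, HasDerivAt (fun y : ℝ => b - y • c) (-c) x := fun x =>
    (((hasDerivAt_id' x).smul_const c).const_sub b).congr_deriv (by rw [one_smul])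
  have hu : ∀ x : ℝ, HasDerivAt (fun y : ℝ => fderiv ℝ f (a - y • b)) (fderiv ℝ (fderiv ℝ f) (a - x • b) (-b)) x := fun x =>
    (hf1d _).hasFDerivAt.comp_hasDerivAt_of_eq x (hl x) rfl
  have hw : ∀ x : ℝ, HasDerivAt (fun y : ℝ => fderiv ℝ (fderiv ℝ f) (a - y • b)) (fderiv ℝ (fderiv ℝ (fderiv ℝ f)) (a - x • b) (-b)) x := fun x =>
    (hf2d _).hasFDerivAt.comp_hasDerivAt_of_eq x (hl x) rfl
  have hψd : ∀ x : ℝ, HasDerivAt (fun y : ℝ => fderiv ℝ f (a - y • b) (b - y • c))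
      (fderiv ℝ (fderiv ℝ f) (a - x • b) (-b) (b - x • c) + fderiv ℝ f (a - x • b) (-c)) x := fun x => (hu x).clm_apply (hv x)
  have hc₂ : ∀ x : ℝ, HasDerivAt (fun y : ℝ => fderiv ℝ (fderiv ℝ f) (a - y • b) (-b))
      (fderiv ℝ (fderiv ℝ (fderiv ℝ f)) (a - x • b) (-b) (-b)) x := fun x =>
    ((hw x).clm_apply (hasDerivAt_const x (-b))).congr_deriv (by rw [map_zero, add_zero])
  have hψ₁d : ∀ x : ℝ, HasDerivAt (fun y : ℝ => fderiv ℝ (fderiv ℝ f) (a - y • b) (-b) (b - y • c) + fderiv ℝ f (a - y • b) (-c))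
      (fderiv ℝ (fderiv ℝ (fderiv ℝ f)) (a - x • b) (-b) (-b) (b - x • c) + fderiv ℝ (fderiv ℝ f) (a - x • b) (-b) (-c) +
        fderiv ℝ (fderiv ℝ f) (a - x • b) (-b) (-c)) x := fun x =>
    ((hc₂ x).clm_apply (hv x)).add (((hu x).clm_apply (hasDerivAt_const x (-c))).congr_deriv (by rw [map_zero, add_zero]))
  have hψ0 : (fun y : ℝ => fderiv ℝ f (a - y • b) (b - y • c)) 0 = 0 := by
    show fderiv ℝ f (a - (0 : ℝ) • b) (b - (0 : ℝ) • c) = 0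
    rw [zero_smul, zero_smul, sub_zero, sub_zero]; exact hc1
  have hψ₁0 : (fun y : ℝ => fderiv ℝ (fderiv ℝ f) (a - y • b) (-b) (b - y • c) + fderiv ℝ f (a - y • b) (-c)) 0 = 0 := by
    show fderiv ℝ (fderiv ℝ f) (a - (0 : ℝ) • b) (-b) (b - (0 : ℝ) • c) + fderiv ℝ f (a - (0 : ℝ) • b) (-c) = 0
    rw [zero_smul, zero_smul, sub_zero, sub_zero, map_neg, map_neg, show ∀ (P : V →L[ℝ] ℝ) (z : V), (-P) z = -(P z) from fun _ _ => rfl]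
    linear_combination (-1 : ℝ) * hc2
  have hvn : ∀ x : ℝ, |x| ≤ |φ| → ‖b - x • c‖ ≤ D₁ + |φ| * D₂ := fun x hx =>
    (norm_sub_le _ _).trans (add_le_add hbn (by rw [norm_smul, Real.norm_eq_abs]; exact mul_le_mul hx hcn (norm_nonneg _) (abs_nonneg _)))
  have hψ₂n : ∀ x : ℝ, |x| ≤ |φ| →
      |fderiv ℝ (fderiv ℝ (fderiv ℝ f)) (a - x • b) (-b) (-b) (b - x • c) + fderiv ℝ (fderiv ℝ f) (a - x • b) (-b) (-c) +
          fderiv ℝ (fderiv ℝ f) (a - x • b) (-b) (-c)| ≤ K₃ * D₁ ^ 2 * (D₁ + |φ| * D₂) + 2 * K₂ * D₁ * D₂ := fun x hx => by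
    have hL₃ : ‖fderiv ℝ (fderiv ℝ (fderiv ℝ f)) (a - x • b)‖ ≤ K₃ := by rw [norm_fderiv_three_eq_norm_iteratedFDeriv]; exact hK₃ _
    have hL₂ : ‖fderiv ℝ (fderiv ℝ f) (a - x • b)‖ ≤ K₂ := by rw [norm_fderiv_two_eq_norm_iteratedFDeriv]; exact hK₂ _
    have hnb : ‖-b‖ ≤ D₁ := by rw [norm_neg]; exact hbn
    have hnc : ‖-c‖ ≤ D₂ := by rw [norm_neg]; exact hcn
    have t1 : |fderiv ℝ (fderiv ℝ (fderiv ℝ f)) (a - x • b) (-b) (-b) (b - x • c)| ≤ K₃ * D₁ ^ 2 * (D₁ + |φ| * D₂) := by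
      rw [← Real.norm_eq_abs]
      refine ((fderiv ℝ (fderiv ℝ (fderiv ℝ f)) (a - x • b) (-b) (-b)).le_opNorm _).trans ?_
      refine (mul_le_mul_of_nonneg_right ((fderiv ℝ (fderiv ℝ (fderiv ℝ f)) (a - x • b)).le_opNorm₂ (-b) (-b)) (norm_nonneg _)).trans ?_
      calc ‖fderiv ℝ (fderiv ℝ (fderiv ℝ f)) (a - x • b)‖ * ‖-b‖ * ‖-b‖ * ‖b - x • c‖ ≤ K₃ * D₁ * D₁ * (D₁ + |φ| * D₂) := by
            gcongr; exact hvn x hx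
        _ = K₃ * D₁ ^ 2 * (D₁ + |φ| * D₂) := by ring
    have t2 : |fderiv ℝ (fderiv ℝ f) (a - x • b) (-b) (-c)| ≤ K₂ * D₁ * D₂ := by
      rw [← Real.norm_eq_abs]
      refine ((fderiv ℝ (fderiv ℝ f) (a - x • b)).le_opNorm₂ (-b) (-c)).trans ?_
      gcongr
    have := abs_add_three (fderiv ℝ (fderiv ℝ (fderiv ℝ f)) (a - x • b) (-b) (-b) (b - x • c)) (fderiv ℝ (fderiv ℝ f) (a - x • b) (-b) (-c))
      (fderiv ℝ (fderiv ℝ f) (a - x • b) (-b) (-c))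
    linarith
  have hψ : |fderiv ℝ f (a - φ • b) (b - φ • c)| ≤ (K₃ * D₁ ^ 2 * (D₁ + |φ| * D₂) + 2 * K₂ * D₁ * D₂) * φ ^ 2 :=
    abs_le_sq_of_hasDerivAt_two hψd hψ₁d hψ0 hψ₁0 hψ₂n
  -- the two remainder corrections
  have key : fderiv ℝ f (a - φ • b - R₀) (b - φ • c - R₁) =
      fderiv ℝ f (a - φ • b) (b - φ • c) + (fderiv ℝ f (a - φ • b - R₀) - fderiv ℝ f (a - φ • b)) (b - φ • c) - fderiv ℝ f (a - φ • b - R₀) R₁ := by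
    simp only [map_sub, show ∀ (P Q : V →L[ℝ] ℝ) (z : V), (P - Q) z = P z - Q z from fun _ _ _ => rfl]; ring
  rw [key]
  have hLip : ‖fderiv ℝ f (a - φ • b - R₀) - fderiv ℝ f (a - φ • b)‖ ≤ K₂ * ‖R₀‖ := by
    have h := (convex_univ (𝕜 := ℝ) (E := V)).norm_image_sub_le_of_norm_fderiv_le (𝕜 := ℝ) (f := fderiv ℝ f) (fun z _ => hf1d z)
      (fun z _ => by rw [norm_fderiv_two_eq_norm_iteratedFDeriv]; exact hK₂ z) (mem_univ (a - φ • b)) (mem_univ (a - φ • b - R₀))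
    rwa [show a - φ • b - R₀ - (a - φ • b) = -R₀ by abel, norm_neg] at h
  have t1 : |(fderiv ℝ f (a - φ • b - R₀) - fderiv ℝ f (a - φ • b)) (b - φ • c)| ≤ K₂ * (D₂ * φ ^ 2) * (D₁ + |φ| * D₂) := by
    have hP : ‖fderiv ℝ f (a - φ • b - R₀) - fderiv ℝ f (a - φ • b)‖ ≤ K₂ * (D₂ * φ ^ 2) := hLip.trans (mul_le_mul_of_nonneg_left hR₀n hK₂0)
    have hP0 : 0 ≤ K₂ * (D₂ * φ ^ 2) := by positivity
    rw [← Real.norm_eq_abs]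
    refine ((fderiv ℝ f (a - φ • b - R₀) - fderiv ℝ f (a - φ • b)).le_opNorm _).trans ?_
    gcongr
    · exact hvn φ le_rfl
  have t2 : |fderiv ℝ f (a - φ • b - R₀) R₁| ≤ K₁ * (D₃ * φ ^ 2) := by
    rw [← Real.norm_eq_abs]
    refine ((fderiv ℝ f (a - φ • b - R₀)).le_opNorm _).trans ?_
    gcongr
    · exact hK₁ _
  have := abs_sub (fderiv ℝ f (a - φ • b) (b - φ • c) + (fderiv ℝ f (a - φ • b - R₀) - fderiv ℝ f (a - φ • b)) (b - φ • c))
    (fderiv ℝ f (a - φ • b - R₀) R₁)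
  have := abs_add_le (fderiv ℝ f (a - φ • b) (b - φ • c)) ((fderiv ℝ f (a - φ • b - R₀) - fderiv ℝ f (a - φ • b)) (b - φ • c))
  linarith [t1, t2, hψ]

end Abstract

end Summit.HubbardSuperconductivity.HubbardSuperconductivity.Theorems.C4a

end
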